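import Summits.QuantumFields.BalabanUV.Beta.GAN24.InsertionWordVolumeLimit

/-!
# `BalabanUV.Beta.GAN24.InsertionWordVolumeLimitSides` — binder row G-an2-4 ∕ (CONV-C), routes C-R6° («VALUES») × R7 («TWO CURRENCIES»), PART 199:
# THE V197 JUNCTION — EL₂ OF EVERY INSERTION WORD ALONG ANY CUBIC VOLUME SEQUENCE THAT CARRIES EL₂ OF THE FINE PROPAGATOR, AND ALONG THE MULTIPLES `m·2(t+1)`
# OF THE EVEN CUBIC VOLUMES UNCONDITIONALLY.  The one-step sockets of PARTs 185–197 are indexed by the unit tori `cubic (d+1) (Lb·s t)`, the Σ-world leg suppliers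
# (PARTs 145–160) by `cubic d (evenPeriod t′)`; the ONLY `evenPeriod`-specific input of the whole supplier chain is the β-cell row an5's `calG_tendsto_Kinf` (EL₂ of
# `𝒢^{(k)}`, Riemann sums over the Brillouin zone, `d ≥ 3`), read in PART 146 as `tendsto_calGlev_pair`.  This file (i) re-runs PART 159 §2 with the volume sequence
# `side t → ∞` FREE and EL₂ of `𝒢^{(k)}` DISPLAYED (`tendsto_word_fine_pair_of_calG`, `tendsto_word_pair_of_calG`), (ii) transports the an5 fact to every side sequence
# `m·evenPeriod t = evenPeriod (m(t+1) − 1)` by a dependent-type-safe subsequence lemma (`tendsto_along_sides`: the readings are a function of the side `n` and of an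
# INSTANCE `NeZero n`, two instances being equal by proof irrelevance), and (iii) concludes EL₂ of every word along `cubic d (m·2(t+1))` (`tendsto_word_pair_mul`) — the
# volumes `M_t = fine (Lb·1) (cubic (s t))`, `s = evenPeriod`, of PART 197's socket (unit b2b-balaban-gan24-p3, gen 62; v1)

NOT IN PRINT; OUR PROOF ([folklore] bookkeeping BY NAME over PART 159 (`tendsto_mul_tailWord_pair`), PART 146 (`tendsto_calGlev_pair`), PART 145 (`exists_fineWindowDecay_calGlev`), PART 151
(`norm_Pmodel_mul_apply_le`, `tendsto_Pmodel_mul_pair`, `tendsto_avgTow_pair_of_fine`), PART 122 (`chain_eq_mul_tailProd`), PART 142 (`l1_windowMap_neg`), the β-cell's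
`BlockKernelVolumeSockets` (`evenPeriod`, `tendsto_evenPeriod`); [Balaban1987RG1] p. 264 (after (1.21)) LOCATES the `T ↗ ℤ^d` limit; nothing printed is a hypothesis).
HONEST FRAMING (cell contract, verbatim): «discharging `BetaPertH` makes Bałaban's UV stability UNCONDITIONAL — a real constructive-QFT result; it is NOT the
continuum limit and NOT the Clay problem.»  HONEST DEPENDENCY (verbatim): «continuum YM on T⁴ ⇐ BetaPertH ∧ nine spine estimates (0/9 proved); BetaPertH ⇐
(D1) ∧ (D4) ∧ CAP+tail; G-an2-4 gates asym, D1 and NE2/3/4.»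

WHAT THIS FILE PROVES (0 sorry, 0 `def`; `𝒢_k = calGlev k`, `P(V) = Pmodel V`, `T_{w,k} = foldr (fun i N ↦ 𝒢_kP(V_i)_kN) 𝒢_k w`, `X_{w,k} = avgTow QBlev (L^d) (k ↦ T_{w,k}) k`, `e = unitIdx⁻¹`):
* §1 (GENERIC) **`tendsto_along_sides`** — a sequence of readings `R n [NeZero n]` converging along a side sequence `s₁` converges along any `s₂` with `s₁ ∘ φ = s₂`, `φ → ∞`
  (no cast: `R n i = R n j` for two instances by proof irrelevance); `evenPeriod_mulIdx`, `tendsto_mulIdx` (`evenPeriod (m(t+1) − 1) = m·evenPeriod t`).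
* §2 **`tendsto_calGlev_pair_mul`** — EL₂ of `𝒢^{(k)}` along `cubic d (m·evenPeriod t)` for every `m ≥ 1` (`d ≥ 3`; an5's `calG_tendsto_Kinf` transported by §1).
* §3 (ANY `side t → ∞`, `d ≥ 1`, EL₂ of `𝒢^{(k)}` along `side` DISPLAYED) **`tendsto_word_fine_pair_of_calG`** (EL₂ of `T_{w,k}` at fine integer pairs, every word, every family of
  Lipschitz backgrounds with common `(α, β)` displaying EL₁), **`tendsto_word_pair_of_calG`** (EL₂ of `X_{w,k}` at unit integer pairs) — PART 159 §2 with the volume sequence free.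
* §4 **`tendsto_word_fine_pair_mul`**, **`tendsto_word_pair_mul`** — the same along `cubic d (m·evenPeriod t)`, every `m ≥ 1`, `d ≥ 3`, UNCONDITIONALLY (§2 fed into §3).
WHAT IT DOES NOT DO: EL₂ of `𝒢^{(k)}` along an ARBITRARY cubic side sequence (an5's Riemann-sum road is typed for `2(t+1)` only; odd sides are not reached here); the decay
half (PART 159 §3 ∕ PART 198 are already torus-generic); the legs' EL₃ and the `ℤ^{d}` END (PART 200).  SUPPLIER work; NEVER «G-an2-4 closed»; NOT (CONV-C), NOT D1, NOT
`BetaPertH`, NOT continuum, NOT Clay.  Records: `HOME/b2b-balaban-gan24-p3/gen62/README.md`.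
-/

noncomputable section

open scoped BigOperators ComplexConjugate Matrix Matrix.Norms.L2Operator
open Filter Topology

namespace Summit.QuantumFields.BalabanUV.Beta.GAN24.InsertionWordVolumeLimitSides

open Literature.MathematicalPhysics.QuantumFieldTheory.Balaban1983to89
open Literature.MathematicalPhysics.QuantumFieldTheory.Balaban1983to89.B5Prop11Plancherel (Tor fine)
open Literature.MathematicalPhysics.QuantumFieldTheory.Balaban1983to89.B5G183RateUnitTower (lev)
open Literature.MathematicalPhysics.QuantumFieldTheory.Balaban1983to89.B12Sec2to5 (l1)
open Literature.MathematicalPhysics.QuantumFieldTheory.Balaban1983to89.Beta (Site windowMap)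
open Literature.MathematicalPhysics.QuantumFieldTheory.Balaban1983to89.Beta.FreeLegDictionary (cubic)
open Literature.MathematicalPhysics.QuantumFieldTheory.Balaban1983to89.Beta.BlockKernelVolumeSockets (evenPeriod tendsto_evenPeriod)
open Literature.MathematicalPhysics.QuantumFieldTheory.Balaban1983to89.Beta.VectorTails (castT)
open Summit.QuantumFields.BalabanUV.T4Continuum
open Summit.QuantumFields.BalabanUV.T4Continuum.CovariantAveragingTower (avgTow)
open Summit.QuantumFields.BalabanUV.T4Continuum.BalabanAveragedTowerUnit (idx QBlev calGlev)
open Summit.QuantumFields.BalabanUV.T4Continuum.BalabanAveragedCoerciveTower (unitIdx)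
open Summit.QuantumFields.BalabanUV.T4Continuum.FirstOrderBackgroundModel (LipschitzBackground Pmodel)
open Summit.QuantumFields.BalabanUV.Beta.GAN24.InsertionChainLawWords (chain_eq_mul_tailProd)
open Summit.QuantumFields.BalabanUV.Beta.GAN24.DiagramVolumeLimitPairs (l1_windowMap_neg)
open Summit.QuantumFields.BalabanUV.Beta.GAN24.FinePropagatorDecay (exists_fineWindowDecay_calGlev)
open Summit.QuantumFields.BalabanUV.Beta.GAN24.FineInsertionVolumeLimit (tendsto_calGlev_pair)
open Summit.QuantumFields.BalabanUV.Beta.GAN24.PerturbedPropagatorVolumeLimit (tendsto_Pmodel_mul_pair norm_Pmodel_mul_apply_le tendsto_avgTow_pair_of_fine)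
open Summit.QuantumFields.BalabanUV.Beta.GAN24.InsertionWordVolumeLimit (tendsto_mul_tailWord_pair)

/-! ## §1 Generic: readings along a subsequence of sides, instance-safe -/

section Sides

/-- **`tendsto_along_sides` — TRANSPORT OF A VOLUME LIMIT ALONG A SUBSEQUENCE OF SIDES, WITHOUT A CAST** [folklore]: let `R n [NeZero n]` be a reading defined for every positive
side `n` (its type may mention the instance), `s₁, s₂` side sequences and `φ → ∞` with `s₁ (φ t) = s₂ t`.  If `t ↦ R (s₁ t)` tends to `l`, so does `t ↦ R (s₂ t)` — the two
instance arguments at equal sides agree by proof irrelevance (`subst`), so no `▸` appears in the statement. -/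
theorem tendsto_along_sides {β : Type*} {R : (n : ℕ) → NeZero n → β} {l : Filter β} {s₁ s₂ φ : ℕ → ℕ}
    [h₁ : ∀ t, NeZero (s₁ t)] [h₂ : ∀ t, NeZero (s₂ t)] (hφ : Tendsto φ atTop atTop) (h : ∀ t, s₁ (φ t) = s₂ t)
    (hR : Tendsto (fun t => R (s₁ t) (h₁ t)) atTop l) : Tendsto (fun t => R (s₂ t) (h₂ t)) atTop l := by
  have key : ∀ (n m : ℕ) (_ : n = m) (i : NeZero n) (j : NeZero m), R n i = R m j := by
    intro n m e; subst e; intro i j; rfl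
  exact (hR.comp hφ).congr fun t => key _ _ (h t) _ _

/-- `evenPeriod (m(t+1) − 1) = m·evenPeriod t` (`m ≥ 1`): every multiple of the even cubic volumes is an even cubic volume. [folklore] -/
theorem evenPeriod_mulIdx (m : ℕ) [NeZero m] (t : ℕ) : evenPeriod (m * (t + 1) - 1) = m * evenPeriod t := by
  have h1 : 1 ≤ m * (t + 1) := Nat.one_le_iff_ne_zero.mpr (mul_ne_zero (NeZero.ne m) (Nat.succ_ne_zero t))
  show 2 * (m * (t + 1) - 1 + 1) = m * (2 * (t + 1))
  rw [Nat.sub_add_cancel h1]; ring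

/-- `t ↦ m(t+1) − 1 → ∞` (`m ≥ 1`). [folklore] -/
theorem tendsto_mulIdx (m : ℕ) [NeZero m] : Tendsto (fun t => m * (t + 1) - 1) atTop atTop := by
  refine tendsto_atTop_mono (fun t => ?_) tendsto_id
  have h1 : 1 ≤ m := Nat.one_le_iff_ne_zero.mpr (NeZero.ne m)
  have h2 : t + 1 ≤ m * (t + 1) := Nat.le_mul_of_pos_left _ h1
  show t ≤ m * (t + 1) - 1
  omega

/-- `t ↦ m·evenPeriod t → ∞` (`m ≥ 1`). [folklore] -/
theorem tendsto_mul_evenPeriod (m : ℕ) [NeZero m] : Tendsto (fun t => m * evenPeriod t) atTop atTop :=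
  Filter.Tendsto.const_mul_atTop' (Nat.pos_of_ne_zero (NeZero.ne m)) tendsto_evenPeriod

end Sides

variable {d : ℕ} (L : ℕ) [NeZero L] (a : ℝ) (ha : 0 < a)

/-! ## §2 EL₂ of the fine propagator along the multiples of the even cubic volumes -/

/-- **`tendsto_calGlev_pair_mul` — EL₂ OF `𝒢^{(k)}` ALONG `cubic d (m·2(t+1))`, EVERY `m ≥ 1`** (`d ≥ 3`): the β-cell row an5's `calG_tendsto_Kinf` (PART 146 `tendsto_calGlev_pair`, sides
`2(t′+1)`) along the subsequence `t′ = m(t+1) − 1`, transported by `tendsto_along_sides`. [cite: Balaban1987RG1, p.264 (after (1.21): the `T ↗ ℤ^d` limit)] -/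
theorem tendsto_calGlev_pair_mul (hd : 3 ≤ d) (m : ℕ) [NeZero m] (k : ℕ) (μ ν : Fin d) (z z' : Fin d → ℤ) :
    ∃ s : ℂ, Tendsto (fun t => calGlev L (cubic d (m * evenPeriod t)) a ha k
      (castT (cubic d (lev L k * (m * evenPeriod t))) z, μ) (castT (cubic d (lev L k * (m * evenPeriod t))) z', ν)) atTop (𝓝 s) := by
  obtain ⟨s, hs⟩ := tendsto_calGlev_pair L a ha hd k μ ν z z'
  exact ⟨s, tendsto_along_sides (R := fun n _ => calGlev L (cubic d n) a ha k (castT (cubic d (lev L k * n)) z, μ) (castT (cubic d (lev L k * n)) z', ν))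
    (s₁ := evenPeriod) (s₂ := fun t => m * evenPeriod t) (tendsto_mulIdx m) (evenPeriod_mulIdx m) hs⟩

/-! ## §3 EL₂ of every insertion word along ANY cubic volume sequence carrying EL₂ of the fine propagator -/

section AnySide

variable {side : ℕ → ℕ} [∀ t, NeZero (side t)]

/-- **`tendsto_word_fine_pair_of_calG` — EL₂ OF THE FINE KERNEL `T_{w,k} = 𝒢P(V_{i₁})𝒢⋯P(V_{i_n})𝒢` AT FINE INTEGER PAIRS ALONG ANY `side t → ∞`, EVERY WORD, MODULO EL₁ OF THE BACKGROUNDS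
AND EL₂ OF `𝒢^{(k)}`** [our proof] (`d ≥ 1`, `a > 0`, level `k`; a family of Lipschitz backgrounds `V_{i,t}` with common `(α, β)`): PART 159's `tendsto_word_fine_pair` with the volume
sequence free — `T_w = 𝒢·R_w`, each letter `P(V_i)𝒢` left-window-decaying volume-free (PART 151 on PART 145, any cubic side) with EL₂ (PART 151 on the displayed EL₂ of `𝒢`).
[cite: Balaban1987RG1, p.264 (after (1.21): the `T ↗ ℤ^d` limit)] -/
theorem tendsto_word_fine_pair_of_calG (hd : 1 ≤ d) (hside : Tendsto side atTop atTop) (k : ℕ)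
    (hGel : ∀ (f g : Fin d) (z z' : Fin d → ℤ), ∃ s : ℂ, Tendsto (fun t => calGlev L (cubic d (side t)) a ha k
      (castT (cubic d (lev L k * side t)) z, f) (castT (cubic d (lev L k * side t)) z', g)) atTop (𝓝 s))
    {σ : Type*} {α β : ℝ} {V : σ → (t : ℕ) → (k : ℕ) → Fin d → (idx L (cubic d (side t)) k → ℂ)} (hV : ∀ i t, LipschitzBackground L (cubic d (side t)) (V i t) α β)
    (hV1 : ∀ i (μ f : Fin d) (z : Fin d → ℤ), ∃ s : ℂ, Tendsto (fun t => V i t k μ (castT (cubic d (lev L k * side t)) z, f)) atTop (𝓝 s))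
    (w : List σ) (f g : Fin d) (z z' : Fin d → ℤ) :
    ∃ s : ℂ, Tendsto (fun t => (List.foldr (fun i N => calGlev L (cubic d (side t)) a ha k * Pmodel L (cubic d (side t)) (V i t) k * N)
        (calGlev L (cubic d (side t)) a ha k) w)
      (castT (cubic d (lev L k * side t)) z, f) (castT (cubic d (lev L k * side t)) z', g)) atTop (𝓝 s) := by
  rcases isEmpty_or_nonempty σ with hσ | ⟨⟨i₀⟩⟩
  · cases w with
    | nil => simp only [List.foldr_nil]; exact hGel f g z z'
    | cons i _ => exact (IsEmpty.false i).elim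
  have hd0 : (0 : ℝ) < d := by exact_mod_cast lt_of_lt_of_le zero_lt_one hd
  have hn : (0 : ℝ) < lev L k := by exact_mod_cast Nat.pos_of_ne_zero (NeZero.ne (lev L k))
  have hside' : Tendsto (fun t => lev L k * side t) atTop atTop :=
    Filter.Tendsto.const_mul_atTop' (Nat.pos_of_ne_zero (NeZero.ne (lev L k))) hside
  have hα : 0 ≤ α := (hV i₀ 0).nonneg.1
  obtain ⟨κ, C, hκ, hC, hdec⟩ := exists_fineWindowDecay_calGlev L a ha
  have hδ : 0 < κ / (d * lev L k) := div_pos hκ (mul_pos hd0 hn)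
  have hGr : ∀ t (w : Site d (lev L k * side t)) (g : Fin d) (y : Site d (lev L k * side t)) (h : Fin d),
      ‖calGlev L (cubic d (side t)) a ha k (w, g) (y, h)‖ ≤ C * Real.exp (-(κ / (d * lev L k)) * l1 (windowMap d (lev L k * side t) (w - y))) :=
    fun t w g y h => hdec (side t) k w y g h
  have hGl : ∀ t (x : Site d (lev L k * side t)) (f : Fin d) (w : Site d (lev L k * side t)) (g : Fin d),
      ‖calGlev L (cubic d (side t)) a ha k (x, f) (w, g)‖ ≤ C * Real.exp (-(κ / (d * lev L k)) * l1 (windowMap d (lev L k * side t) (w - x))) := by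
    intro t x f w g
    have h := hdec (side t) k x w f g
    rwa [show x - w = -(w - x) from (neg_sub w x).symm, l1_windowMap_neg] at h
  set CX : ℝ := d * (α * lev L k * ((Real.exp (3 * (κ / (d * lev L k))) + 1) * C)) with hCX
  have hCX0 : 0 ≤ CX := by positivity
  -- the letters `A_i = P(V_i)𝒢`: left-window decay and EL₂
  have hXdecl : ∀ i t (x : Site d (lev L k * side t)) (f : Fin d) (w : Site d (lev L k * side t)) (g : Fin d),
      ‖(Pmodel L (cubic d (side t)) (V i t) k * calGlev L (cubic d (side t)) a ha k) (x, f) (w, g)‖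
        ≤ CX * Real.exp (-(κ / (d * lev L k)) * l1 (windowMap d (lev L k * side t) (w - x))) := by
    intro i t x f w g
    have h := norm_Pmodel_mul_apply_le L (side t) (hV i t) k hC hδ.le (hGr t) x f w g
    rwa [show x - w = -(w - x) from (neg_sub w x).symm, l1_windowMap_neg] at h
  have hXel : ∀ i (f g : Fin d) (z z' : Fin d → ℤ), ∃ s : ℂ, Tendsto (fun t => (Pmodel L (cubic d (side t)) (V i t) k * calGlev L (cubic d (side t)) a ha k)
      (castT (cubic d (lev L k * side t)) z, f) (castT (cubic d (lev L k * side t)) z', g)) atTop (𝓝 s) :=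
    fun i => tendsto_Pmodel_mul_pair L (side := side) k (V i) (hV1 i) (G := fun t => calGlev L (cubic d (side t)) a ha k) hGel
  -- the right shift `T_w = 𝒢·R_w`
  have e : ∀ t, List.foldr (fun i N => calGlev L (cubic d (side t)) a ha k * Pmodel L (cubic d (side t)) (V i t) k * N) (calGlev L (cubic d (side t)) a ha k) w
      = calGlev L (cubic d (side t)) a ha k
        * List.foldr (fun i N => Pmodel L (cubic d (side t)) (V i t) k * calGlev L (cubic d (side t)) a ha k * N) 1 w :=
    fun t => chain_eq_mul_tailProd (calGlev L (cubic d (side t)) a ha k) (fun i => Pmodel L (cubic d (side t)) (V i t) k) w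
  simp only [e]
  exact tendsto_mul_tailWord_pair (d := d) (F := Fin d) (side := fun t => lev L k * side t) hside'
    (G := fun t => calGlev L (cubic d (side t)) a ha k)
    (A := fun i t => Pmodel L (cubic d (side t)) (V i t) k * calGlev L (cubic d (side t)) a ha k) hδ hCX0 hGl hXdecl hGel hXel w f g z z'

/-- **`tendsto_word_pair_of_calG` — EL₂ OF THE AVERAGED WORD `X_{w,k} = L^{dk}Q_kT_{w,k}Q_kᴴ` ON THE UNIT LATTICE ALONG ANY `side t → ∞`, EVERY WORD, MODULO EL₁ OF THE BACKGROUNDS AND EL₂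
OF `𝒢^{(k)}`** [our proof] (`d ≥ 1`): PART 151's middle-free stencil on `tendsto_word_fine_pair_of_calG`. [cite: Balaban1987RG1, p.264 (after (1.21): the `T ↗ ℤ^d` limit)] -/
theorem tendsto_word_pair_of_calG (hd : 1 ≤ d) (hside : Tendsto side atTop atTop) (k : ℕ)
    (hGel : ∀ (f g : Fin d) (z z' : Fin d → ℤ), ∃ s : ℂ, Tendsto (fun t => calGlev L (cubic d (side t)) a ha k
      (castT (cubic d (lev L k * side t)) z, f) (castT (cubic d (lev L k * side t)) z', g)) atTop (𝓝 s))
    {σ : Type*} {α β : ℝ} {V : σ → (t : ℕ) → (k : ℕ) → Fin d → (idx L (cubic d (side t)) k → ℂ)} (hV : ∀ i t, LipschitzBackground L (cubic d (side t)) (V i t) α β)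
    (hV1 : ∀ i (μ f : Fin d) (z : Fin d → ℤ), ∃ s : ℂ, Tendsto (fun t => V i t k μ (castT (cubic d (lev L k * side t)) z, f)) atTop (𝓝 s))
    (w : List σ) (μ ν : Fin d) (z z' : Fin d → ℤ) :
    ∃ s : ℂ, Tendsto (fun t => (avgTow (QBlev L (cubic d (side t))) ((L : ℝ) ^ d)
        (fun k' => List.foldr (fun i N => calGlev L (cubic d (side t)) a ha k' * Pmodel L (cubic d (side t)) (V i t) k' * N)
          (calGlev L (cubic d (side t)) a ha k') w) k)
      ((unitIdx L (cubic d (side t))).symm (castT (cubic d (side t)) z, μ)) ((unitIdx L (cubic d (side t))).symm (castT (cubic d (side t)) z', ν))) atTop (𝓝 s) := by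
  obtain ⟨s, hs⟩ := tendsto_avgTow_pair_of_fine L k
    (X := fun t k' => List.foldr (fun i N => calGlev L (cubic d (side t)) a ha k' * Pmodel L (cubic d (side t)) (V i t) k' * N)
      (calGlev L (cubic d (side t)) a ha k') w)
    (fun f g u u' => tendsto_word_fine_pair_of_calG L a ha hd hside k hGel hV hV1 w f g u u') μ ν z z'
  refine ⟨s, hs.congr fun t => ?_⟩
  simp only [Matrix.reindex_apply, Matrix.submatrix_apply]

end AnySide

/-! ## §4 Along the multiples of the even cubic volumes, unconditionally -/

/-- **`tendsto_word_fine_pair_mul` — EL₂ OF `T_{w,k}` AT FINE INTEGER PAIRS ALONG `cubic d (m·2(t+1))`, EVERY `m ≥ 1`, EVERY WORD, MODULO ONLY EL₁ OF THE BACKGROUNDS** [our proof] (`d ≥ 3`):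
§3 with §2's EL₂ of `𝒢^{(k)}`. [cite: Balaban1987RG1, p.264 (after (1.21): the `T ↗ ℤ^d` limit)] -/
theorem tendsto_word_fine_pair_mul (hd : 3 ≤ d) (m : ℕ) [NeZero m] (k : ℕ) {σ : Type*} {α β : ℝ}
    {V : σ → (t : ℕ) → (k : ℕ) → Fin d → (idx L (cubic d (m * evenPeriod t)) k → ℂ)} (hV : ∀ i t, LipschitzBackground L (cubic d (m * evenPeriod t)) (V i t) α β)
    (hV1 : ∀ i (μ f : Fin d) (z : Fin d → ℤ), ∃ s : ℂ, Tendsto (fun t => V i t k μ (castT (cubic d (lev L k * (m * evenPeriod t))) z, f)) atTop (𝓝 s))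
    (w : List σ) (f g : Fin d) (z z' : Fin d → ℤ) :
    ∃ s : ℂ, Tendsto (fun t => (List.foldr (fun i N => calGlev L (cubic d (m * evenPeriod t)) a ha k * Pmodel L (cubic d (m * evenPeriod t)) (V i t) k * N)
        (calGlev L (cubic d (m * evenPeriod t)) a ha k) w)
      (castT (cubic d (lev L k * (m * evenPeriod t))) z, f) (castT (cubic d (lev L k * (m * evenPeriod t))) z', g)) atTop (𝓝 s) :=
  tendsto_word_fine_pair_of_calG L a ha (le_trans (by norm_num) hd) (side := fun t => m * evenPeriod t) (tendsto_mul_evenPeriod m) k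
    (tendsto_calGlev_pair_mul L a ha hd m k) hV hV1 w f g z z'

/-- **`tendsto_word_pair_mul` — EL₂ OF THE AVERAGED WORD `X_{w,k}` ON THE UNIT LATTICE ALONG `cubic d (m·2(t+1))`, EVERY `m ≥ 1`, EVERY WORD, MODULO ONLY EL₁ OF THE BACKGROUNDS** [our proof]
(`d ≥ 3`): the census-V197 junction for the leg words — the volumes `fine (Lb·1) (cubic (evenPeriod t))` of PART 197's socket are `cubic (Lb·1·evenPeriod t)` definitionally.
[cite: Balaban1987RG1, p.264 (after (1.21): the `T ↗ ℤ^d` limit)] -/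
theorem tendsto_word_pair_mul (hd : 3 ≤ d) (m : ℕ) [NeZero m] (k : ℕ) {σ : Type*} {α β : ℝ}
    {V : σ → (t : ℕ) → (k : ℕ) → Fin d → (idx L (cubic d (m * evenPeriod t)) k → ℂ)} (hV : ∀ i t, LipschitzBackground L (cubic d (m * evenPeriod t)) (V i t) α β)
    (hV1 : ∀ i (μ f : Fin d) (z : Fin d → ℤ), ∃ s : ℂ, Tendsto (fun t => V i t k μ (castT (cubic d (lev L k * (m * evenPeriod t))) z, f)) atTop (𝓝 s))
    (w : List σ) (μ ν : Fin d) (z z' : Fin d → ℤ) :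
    ∃ s : ℂ, Tendsto (fun t => (avgTow (QBlev L (cubic d (m * evenPeriod t))) ((L : ℝ) ^ d)
        (fun k' => List.foldr (fun i N => calGlev L (cubic d (m * evenPeriod t)) a ha k' * Pmodel L (cubic d (m * evenPeriod t)) (V i t) k' * N)
          (calGlev L (cubic d (m * evenPeriod t)) a ha k') w) k)
      ((unitIdx L (cubic d (m * evenPeriod t))).symm (castT (cubic d (m * evenPeriod t)) z, μ))
      ((unitIdx L (cubic d (m * evenPeriod t))).symm (castT (cubic d (m * evenPeriod t)) z', ν))) atTop (𝓝 s) :=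
  tendsto_word_pair_of_calG L a ha (le_trans (by norm_num) hd) (side := fun t => m * evenPeriod t) (tendsto_mul_evenPeriod m) k
    (tendsto_calGlev_pair_mul L a ha hd m k) hV hV1 w μ ν z z'

end Summit.QuantumFields.BalabanUV.Beta.GAN24.InsertionWordVolumeLimitSides

end
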